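import Mathlib.Analysis.Fourier.LpSpace
import Mathlib.Analysis.Fourier.FourierTransformDeriv
import Mathlib.MeasureTheory.Integral.Prod
import Literature.Analysis.FunctionSpaces.FourierSobolevNormEmbeddingProofs
import HarnessLib

/-!
# Route PerpetualPump · `EulerTypeIGlue` — toolkit VI: the triple product formula
# `∫ a b c = ∫∫ â(ξ₁) b̂(ξ₂) ĉ(-ξ₁-ξ₂)`

Support file for the support item `EulerTypeIGlue` (stmt-NavierStokesRegularity-1838). The
identification of Tao's Fourier-side Euler form (1.3) with the physical-space trilinear form
`∫ ⟪u, (u·∇)ψ⟫` rests on the elementary Plancherel-type formula for a product of three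
functions: if `a`, `b` are (a.e.) the inverse Fourier integrals of integrable `A`, `B`, and `c`
is integrable, then `∫ a(x) b(x) c(x) dx = ∫∫ A(ξ₁) B(ξ₂) ĉ(-ξ₁-ξ₂) dξ₁ dξ₂`. It is proved with
Mathlib's multiplication formula `∫ (𝓕 g) w = ∫ g (𝓕 w)`
(`VectorFourier.integral_fourierIntegral_smul_eq_flip`) applied twice and the modulation rule
`𝓕(e^{-2πi⟨·,η⟩} c)(ξ) = ĉ(ξ + η)`; no pointwise Fourier inversion is needed.

## References

* E. M. Stein, G. Weiss, *Introduction to Fourier Analysis on Euclidean Spaces* (1971), Ch. I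
  §1, Thm. 1.15 (multiplication formula) and (1.6)–(1.7).
* T. Tao, J. Amer. Math. Soc. 29 (2016), arXiv:1402.0290v3, §1.1 (1.3) ("which one can write
  in Fourier space as …"). [Tao2016AveragedNS]
-/

noncomputable section

open MeasureTheory Set Filter Topology FourierTransform
open scoped ENNReal NNReal FourierTransform RealInnerProductSpace

set_option linter.dupNamespace false

namespace Summit.NavierStokesRegularity.NavierStokesRegularity.Theorems.PerpetualPumpEulerTypeIGlue

variable {V : Type*} [NormedAddCommGroup V] [InnerProductSpace ℝ V] [FiniteDimensional ℝ V]
  [MeasurableSpace V] [BorelSpace V]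

/-! ### Characters and modulation -/

/-- The multiplication formula `∫ (𝓕 g) • w = ∫ g • (𝓕 w)` for integrable scalar `g`, `w`
(Mathlib `VectorFourier.integral_fourierIntegral_smul_eq_flip`). [folklore] -/
theorem integral_fourier_mul_eq_of_integrable {w g : V → ℂ} (hw : Integrable w) (hg : Integrable g) :
    ∫ x, (𝓕 g) x * w x = ∫ ξ, g ξ * (𝓕 w) ξ := by
  have h := VectorFourier.integral_fourierIntegral_smul_eq_flip (e := 𝐞) (μ := volume)
    (ν := volume) (L := innerₗ V) (f := g) (g := w) Real.continuous_fourierChar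
    continuous_inner hg hw
  have hflip : (innerₗ V).flip = innerₗ V := by
    ext v w'
    rw [LinearMap.flip_apply, innerₗ_apply_apply, innerₗ_apply_apply, real_inner_comm]
  rw [hflip] at h
  simp only [smul_eq_mul] at h
  exact h

omit [FiniteDimensional ℝ V] [MeasurableSpace V] [BorelSpace V] in
/-- The character `x ↦ e^{-2πi⟨x,η⟩}` is continuous. [folklore] -/
theorem continuous_fourierChar_neg_inner (η : V) :
    Continuous fun x : V => ((𝐞 (-⟪x, η⟫) : Circle) : ℂ) :=
  continuous_subtype_val.comp (Real.continuous_fourierChar.comp (continuous_id.inner continuous_const).neg)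

/-- A modulated integrable function is integrable. [folklore] -/
theorem integrable_fourierChar_mul {c : V → ℂ} (hc : Integrable c) (η : V) :
    Integrable (fun x : V => ((𝐞 (-⟪x, η⟫) : Circle) : ℂ) * c x) := by
  refine Integrable.mono' hc.norm ((continuous_fourierChar_neg_inner η).aestronglyMeasurable.mul hc.1)
    (Eventually.of_forall fun x => ?_)
  rw [norm_mul, Circle.norm_coe, one_mul]

/-- **Modulation rule**: `𝓕(e^{-2πi⟨·,η⟩} c)(ξ) = ĉ(ξ + η)`. [folklore] -/
theorem fourier_fourierChar_mul (c : V → ℂ) (η ξ : V) :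
    𝓕 (fun x : V => ((𝐞 (-⟪x, η⟫) : Circle) : ℂ) * c x) ξ = 𝓕 c (ξ + η) := by
  rw [Real.fourier_eq, Real.fourier_eq]
  refine integral_congr_ae (Eventually.of_forall fun x => ?_)
  simp only [Circle.smul_def, Real.fourierChar_apply, smul_eq_mul, inner_add_right, neg_add]
  rw [← mul_assoc, ← Complex.exp_add]
  congr 1
  push_cast
  ring

/-! ### Inverse Fourier integrals of integrable functions -/

/-- The product of a bounded continuous function with an integrable one is integrable. [folklore] -/
theorem integrable_mul_of_norm_le {k c : V → ℂ} (hk : Continuous k) {K : ℝ} (hK : ∀ x, ‖k x‖ ≤ K)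
    (hc : Integrable c) : Integrable (fun x => k x * c x) := by
  refine Integrable.mono' (hc.norm.const_mul K) (hk.aestronglyMeasurable.mul hc.1)
    (Eventually.of_forall fun x => ?_)
  rw [norm_mul]
  exact mul_le_mul_of_nonneg_right (hK x) (norm_nonneg _)

/-! ### The triple product formula -/

/-- **First multiplication step**: `∫ (𝓕⁻¹A) k = ∫ A(ξ) 𝓕k(-ξ)` for integrable `A`, `k`. [folklore] -/
theorem integral_fourierInv_mul_eq {A k : V → ℂ} (hA : Integrable A) (hk : Integrable k) :
    ∫ x, 𝓕⁻ A x * k x = ∫ ξ, A ξ * 𝓕 k (-ξ) := by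
  rw [Real.fourierInv_eq_fourier_comp_neg, integral_fourier_mul_eq_of_integrable hk hA.comp_neg]
  rw [← integral_neg_eq_self]
  simp only [neg_neg]

/-- **Second multiplication step**: `𝓕((𝓕⁻¹B) c)(η) = ∫ B(ξ₂) ĉ(η - ξ₂) dξ₂` for integrable `B`, `c`. [folklore] -/
theorem fourier_fourierInv_mul_eq {B c : V → ℂ} (hB : Integrable B) (hc : Integrable c) (η : V) :
    𝓕 (fun x => 𝓕⁻ B x * c x) η = ∫ ξ, B ξ * 𝓕 c (η - ξ) := by
  -- `𝓕((𝓕⁻¹B) c)(η) = ∫ (𝓕⁻¹B)(x) (e^{-2πi⟨x,η⟩} c(x)) dx`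
  have h1 : 𝓕 (fun x => 𝓕⁻ B x * c x) η =
      ∫ x, 𝓕⁻ B x * (((𝐞 (-⟪x, η⟫) : Circle) : ℂ) * c x) := by
    rw [Real.fourier_eq]
    refine integral_congr_ae (Eventually.of_forall fun x => ?_)
    simp only [Circle.smul_def, smul_eq_mul]
    ring
  rw [h1, integral_fourierInv_mul_eq hB (integrable_fourierChar_mul hc η)]
  refine integral_congr_ae (Eventually.of_forall fun ξ => ?_)
  dsimp only
  erw [fourier_fourierChar_mul c η (-ξ)]
  rw [neg_add_eq_sub]

/-- **The triple product formula.** Let `A`, `B`, `c` be integrable on `V`, and let `a`, `b` agree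
a.e. with the inverse Fourier integrals `𝓕⁻¹A`, `𝓕⁻¹B`. Then
`∫ a(x) b(x) c(x) dx = ∫∫ A(ξ₁) B(ξ₂) ĉ(-ξ₁-ξ₂) dξ₁ dξ₂`
(the Fourier transform turns the pointwise product into the convolution on `ξ₁ + ξ₂ + ξ₃ = 0`;
Stein–Weiss Ch. I §1). [folklore] -/
theorem integral_mul_mul_eq_integral_prod {a b c A B : V → ℂ} (hA : Integrable A) (hB : Integrable B)
    (hc : Integrable c) (ha : a =ᵐ[volume] 𝓕⁻ A) (hb : b =ᵐ[volume] 𝓕⁻ B) :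
    ∫ x, a x * b x * c x = ∫ p : V × V, A p.1 * B p.2 * 𝓕 c (-p.1 - p.2) := by
  -- replace `a`, `b` by the continuous representatives
  have hab : ∫ x, a x * b x * c x = ∫ x, 𝓕⁻ A x * (𝓕⁻ B x * c x) := by
    refine integral_congr_ae ?_
    filter_upwards [ha, hb] with x hx hy
    rw [hx, hy, mul_assoc]
  -- `k = (𝓕⁻¹B) c` is integrable
  have hk : Integrable (fun x => 𝓕⁻ B x * c x) :=
    integrable_mul_of_norm_le
      (Literature.Analysis.FunctionSpaces.SobolevEmbeddingHalf.continuous_fourierIntegralInv hB)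
      (Literature.Analysis.FunctionSpaces.SobolevEmbeddingHalf.norm_fourierIntegralInv_le_integral_norm B) hc
  rw [hab, integral_fourierInv_mul_eq hA hk]
  -- the inner Fourier transform
  have hinner : ∀ ξ₁, 𝓕 (fun x => 𝓕⁻ B x * c x) (-ξ₁) = ∫ ξ₂, B ξ₂ * 𝓕 c (-ξ₁ - ξ₂) := fun ξ₁ =>
    fourier_fourierInv_mul_eq hB hc (-ξ₁)
  simp_rw [hinner]
  -- Fubini
  have hbound : ∀ ξ, ‖𝓕 c ξ‖ ≤ ∫ x, ‖c x‖ := fun ξ =>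
    VectorFourier.norm_fourierIntegral_le_integral_norm 𝐞 volume (innerₗ V) c ξ
  have hFc : Continuous (𝓕 c) :=
    VectorFourier.fourierIntegral_continuous Real.continuous_fourierChar continuous_inner hc
  have hint : Integrable (fun p : V × V => A p.1 * B p.2 * 𝓕 c (-p.1 - p.2)) (volume.prod volume) := by
    have hprod : Integrable (fun p : V × V => A p.1 * B p.2) (volume.prod volume) := hA.mul_prod hB
    refine Integrable.mono' (hprod.norm.mul_const (∫ x, ‖c x‖)) ?_ (Eventually.of_forall fun p => ?_)
    · exact hprod.1.mul ((hFc.comp (continuous_fst.neg.sub continuous_snd)).aestronglyMeasurable)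
    · rw [norm_mul]
      exact mul_le_mul_of_nonneg_left (hbound _) (norm_nonneg _)
  rw [Measure.volume_eq_prod, integral_prod _ hint]
  refine integral_congr_ae (Eventually.of_forall fun ξ₁ => ?_)
  dsimp only
  rw [← integral_const_mul]
  refine integral_congr_ae (Eventually.of_forall fun ξ₂ => ?_)
  ring

end Summit.NavierStokesRegularity.NavierStokesRegularity.Theorems.PerpetualPumpEulerTypeIGlue

end
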